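import Literature.NumberTheory.GaloisRepresentations.CentralInvolutionBreakProofs
import Literature.NumberTheory.GaloisRepresentations.HerbrandTheoremProofs
import HarnessLib

/-!
# The top break through the quotient by a central involution: `φ_{L/K}(b) = φ_{E/K}(b)`,
# `E = L^ι` (Serre, *Local Fields*, Ch. IV §3, Prop. 15)

`Proofs` file (theorems only, no definitions, no named facts) in topic
`NumberTheory/GaloisRepresentations`, sequel of `CentralInvolutionBreakProofs`, landed by the
seat of bsd.S15
(`Literature.NumberTheory.EllipticCurves.conductorNorm_eq_artinConductorNat_of_isElliptic`) as the
second generic brick for the Galois side of Ogg's formula at the supersingular potentially good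
places above `2` (Silverman, *ATAEC*, Thm. IV.11.1, case `p = 2`, PDF p. 366).

Setting: `R` Dedekind with fraction field `K`, `L/K` finite Galois with group `G`,
`S = integralClosure R L`, `𝔓` a maximal ideal of `S` with separable residue extension, and a
normal subextension `E/K` whose fixing group is a group `{1, ι}` of order `2`
(`hker : σ|_E = 1 ↔ σ = 1 ∨ σ = ι`; e.g. `E = L^{⟨ι⟩}` for a central involution `ι`,
`restrictNormalHom_fixedField_eq_one_iff`).  Write `Q = Gal(E/K)`, `𝔓_E = 𝔓 ∩ E`, and let
`i_G(ι) = b + 1`, i.e. `b` is the break of the quadratic extension `L/E` at `𝔓`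
(`lowerIndex_eq_of_smul_eq_neg` computes it).

* `herbrandPhi_eq_herbrandPhi_quotient_of_lowerIndex_eq` — **`φ_{L/K}(b) = φ_{E/K}(b)`**: by the
  transitivity `φ_{L/K} = φ_{E/K} ∘ φ_{L/E}` (Serre's Prop. 15,
  `herbrandPhi_eq_herbrandPhi_comp_of_indexFormula` with the index formula `IndexFormula_holds`,
  the surjectivity of inertia `map_inertia_restrictNormalHom` and the eventual triviality of the
  filtration) and `φ_{L/E} = id` on `[0, b]` (the filtration of `Gal(L/E) = {1, ι}` is constant
  up to `b`, `herbrandPhi_eq_self_of_le`);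
* `card_inertia_eq_two_mul_card_inertia_quotient` — `#G₀ = 2 · #Q₀` when `ι ∈ G₀`;
* `restrictNormalHom_fixedField_eq_one_iff` — the hypothesis `hker` for `E = L^{⟨ι⟩}`, `ι² = 1`.

With `CentralInvolutionBreakProofs`: if moreover every non-trivial wild element of `G` has `ι`
among its powers, the largest upper ramification break of `L/K` at `𝔓` is
`φ_{L/K}(b) = φ_{E/K}(b)`, and `#Q₀ · φ_{E/K}(b) = b + Σ_{τ ∈ Q₁ ∖ 1} (i_Q(τ) - 1)` is computed
inside the smaller field `E` (`card_mul_herbrandPhi_eq_of_lowerIndex_eq_of_wild` for `Q`), where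
— in the application `L = K(E[3])`, `E = K(x(E[3]))`, `𝔓 ∣ 2` — `Q₁` is a four-group of
involutions whose indices are again given by `lowerIndex_eq_of_smul_eq_neg`.

## References

* J.-P. Serre, *Local Fields*, GTM 67 (1979), Ch. IV §1 Prop. 2–3, §3 Lemmas 3–5 and
  Prop. 14–15 (pp. 61–76); Ch. I §7 Prop. 22. [SerreLocalFields1979]
* J. H. Silverman, *Advanced Topics in the Arithmetic of Elliptic Curves*, GTM 151 (1994),
  §IV.10 (definition of `δ`, PDF p. 358), Thm. IV.11.1 case `p = 2` (p. 366). [SilvermanATAEC1994]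

## Design

No definitions; the subextension `E` is a parameter with the kernel hypothesis `hker`, so that
users may present `E` by generators.  `noncomputable section`; namespace
`Literature.NumberTheory.GaloisRepresentations`.  Axioms: `propext`, `Classical.choice`,
`Quot.sound`.
-/

noncomputable section

open scoped Pointwise

namespace Literature.NumberTheory.GaloisRepresentations

/-! ### The fixing group `{1, ι}` of `L^{⟨ι⟩}` -/

section Kernel

variable {K L : Type*} [Field K] [Field L] [Algebra K L] [FiniteDimensional K L]

/-- For `ι ∈ Gal(L/K)` with `ι² = 1`, the subgroup `⟨ι⟩` is `{1, ι}`. [folklore] -/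
theorem mem_zpowers_iff_of_mul_self_eq_one {G : Type*} [Group G] {ι : G} (hι : ι * ι = 1)
    (σ : G) : σ ∈ Subgroup.zpowers ι ↔ σ = 1 ∨ σ = ι := by
  have hinv : ι⁻¹ = ι := inv_eq_of_mul_eq_one_right hι
  let H : Subgroup G :=
    { carrier := {σ | σ = 1 ∨ σ = ι}
      one_mem' := Or.inl rfl
      mul_mem' := by
        intro a c ha hc
        simp only [Set.mem_setOf_eq] at ha hc ⊢
        rcases ha with ha | ha <;> rcases hc with hc | hc <;> simp [ha, hc, hι]
      inv_mem' := by
        intro a ha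
        simp only [Set.mem_setOf_eq] at ha ⊢
        rcases ha with ha | ha <;> simp [ha, hinv] }
  constructor
  · intro h
    have hle : Subgroup.zpowers ι ≤ H := (Subgroup.zpowers_le (H := H)).mpr (Or.inr rfl)
    exact hle h
  · rintro (h | h)
    · rw [h]; exact Subgroup.one_mem _
    · rw [h]; exact Subgroup.mem_zpowers _

/-- **The kernel of `Gal(L/K) → Gal(L^{⟨ι⟩}/K)` is `{1, ι}`** for `L/K` finite Galois and
`ι ∈ Gal(L/K)` with `ι² = 1` such that `L^{⟨ι⟩}/K` is normal (e.g. `ι` central): the kernel is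
the fixing group of the fixed field, i.e. `⟨ι⟩` (Galois correspondence). [folklore] -/
theorem restrictNormalHom_fixedField_eq_one_iff [IsGalois K L] {ι : L ≃ₐ[K] L}
    (hι : ι * ι = 1) [Normal K (IntermediateField.fixedField (Subgroup.zpowers ι))]
    (σ : L ≃ₐ[K] L) :
    AlgEquiv.restrictNormalHom (IntermediateField.fixedField (Subgroup.zpowers ι)) σ = 1 ↔
      σ = 1 ∨ σ = ι := by
  rw [← MonoidHom.mem_ker, IntermediateField.restrictNormalHom_ker,
    IntermediateField.fixingSubgroup_fixedField]
  exact mem_zpowers_iff_of_mul_self_eq_one hι σ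

end Kernel

/-! ### `φ_{L/K}(b) = φ_{E/K}(b)` for `Gal(L/E) = {1, ι}`, `i_G(ι) = b + 1` -/

section Quotient

variable (R : Type*) {K L : Type*} [CommRing R] [IsDedekindDomain R] [Field K] [Field L]
  [Algebra R K] [IsFractionRing R K] [Algebra R L] [Algebra K L] [IsScalarTower R K L]
  [FiniteDimensional K L] [IsGalois K L] (E : IntermediateField K L) [Normal K E]
  (𝔓 : Ideal (integralClosure R L)) [𝔓.IsMaximal]
  [Algebra.IsSeparable (R ⧸ 𝔓.under R) (integralClosure R L ⧸ 𝔓)]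

omit [IsDedekindDomain R] [IsFractionRing R K] [FiniteDimensional K L] [IsGalois K L] [𝔓.IsMaximal]
  [Algebra.IsSeparable (R ⧸ 𝔓.under R) (integralClosure R L ⧸ 𝔓)] in
/-- If the kernel of `Gal(L/K) → Gal(E/K)` is `{1, ι}` and `ι ∈ G_b` (`i_G(ι) ≥ b + 1`), then the
lower filtration of `H = Gal(L/E)` at `𝔓` is all of `H` up to `b`: `H_i = H_0` for `i ≤ b`
(`H_i = G_i ∩ H`, Serre's Prop. 2).  [cite: SerreLocalFields1979, Ch. IV §1 Prop. 2] -/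
theorem ramificationSubgroup_ker_eq_of_le {ι : L ≃ₐ[K] L}
    (hker : ∀ σ : L ≃ₐ[K] L, AlgEquiv.restrictNormalHom E σ = 1 ↔ σ = 1 ∨ σ = ι)
    {b : ℕ} (hb : ι ∈ 𝔓.ramificationSubgroup (L ≃ₐ[K] L) b) {i : ℕ} (hi : i ≤ b) :
    𝔓.ramificationSubgroup
        (AlgEquiv.restrictNormalHom E : (L ≃ₐ[K] L) →* (E ≃ₐ[K] E)).ker i =
      𝔓.ramificationSubgroup
        (AlgEquiv.restrictNormalHom E : (L ≃ₐ[K] L) →* (E ≃ₐ[K] E)).ker 0 := by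
  have htop : ∀ j ≤ b, 𝔓.ramificationSubgroup
      (AlgEquiv.restrictNormalHom E : (L ≃ₐ[K] L) →* (E ≃ₐ[K] E)).ker j = ⊤ := by
    intro j hj
    ext h
    simp only [Subgroup.mem_top, iff_true]
    rw [mem_ramificationSubgroup_subgroup_iff]
    rcases (hker h).mp (MonoidHom.mem_ker.mp h.2) with h1 | h1
    · rw [h1]; exact Subgroup.one_mem _
    · rw [h1]; exact 𝔓.ramificationSubgroup_antitone _ hj hb
  rw [htop i hi, htop 0 (Nat.zero_le b)]

set_option synthInstance.maxHeartbeats 400000 in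
/-- **`φ_{L/K}(b) = φ_{E/K}(b)` when `Gal(L/E) = {1, ι}` and `i_G(ι) = b + 1`.**  `R` Dedekind
with fraction field `K`, `L/K` finite Galois, `E/K` a normal subextension whose fixing group is
`{1, ι}`, `𝔓` a maximal ideal of `S_L` with separable residue extension, `𝔓_E = 𝔓 ∩ E`.  If
`ι ∈ G_b` then `φ_{L/K}(b) = φ_{E/K}(b)` (Herbrand functions of `Gal(L/K)` at `𝔓` and of
`Gal(E/K)` at `𝔓_E`): by Serre's Prop. 15, `φ_{L/K} = φ_{E/K} ∘ φ_{L/E}`, and `φ_{L/E}(b) = b`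
since the filtration of `Gal(L/E) = {1, ι}` is constant on `[0, b]`.  In particular, when
`i_G(ι) = b + 1` is the last lower break of `L/K`, the largest upper break `φ_{L/K}(b)` of `L/K`
is computed in `E`.  [cite: SerreLocalFields1979, Ch. IV §3 Prop. 15 (pp. 75–76), with §1 Prop. 2–3] -/
theorem herbrandPhi_eq_herbrandPhi_quotient_of_mem {ι : L ≃ₐ[K] L}
    (hker : ∀ σ : L ≃ₐ[K] L, AlgEquiv.restrictNormalHom E σ = 1 ↔ σ = 1 ∨ σ = ι)
    {b : ℕ} (hb : ι ∈ 𝔓.ramificationSubgroup (L ≃ₐ[K] L) b) :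
    herbrandPhi 𝔓 (L ≃ₐ[K] L) b =
      herbrandPhi (𝔓.comap (E.integralClosureInclusion R)) (E ≃ₐ[K] E) b := by
  haveI : IsFractionRing (integralClosure R L) L :=
    integralClosure.isFractionRing_of_finite_extension K L
  haveI : FaithfulSMul (L ≃ₐ[K] L) (integralClosure R L) :=
    (IsGaloisGroup.of_isFractionRing (L ≃ₐ[K] L) R (integralClosure R L) K L).faithful
  haveI : IsNoetherianRing (integralClosure R L) := integralClosure.isNoetherianRing (K := K) L
  set π : (L ≃ₐ[K] L) →* (E ≃ₐ[K] E) := AlgEquiv.restrictNormalHom E with hπ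
  obtain ⟨N, hN⟩ := Ideal.ramificationSubgroup_eventually_eq_bot_holds 𝔓 (L ≃ₐ[K] L)
    (Ideal.IsMaximal.ne_top inferInstance)
  have hI : (𝔓.ramificationSubgroup (L ≃ₐ[K] L) 0).map π =
      (𝔓.comap (E.integralClosureInclusion R)).ramificationSubgroup (E ≃ₐ[K] E) 0 := by
    rw [Ideal.ramificationSubgroup_zero, Ideal.ramificationSubgroup_zero]
    exact map_inertia_restrictNormalHom R E 𝔓
  have h3 : IndexFormula 𝔓 (𝔓.comap (E.integralClosureInclusion R)) π := IndexFormula_holds R E 𝔓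
  rw [herbrandPhi_eq_herbrandPhi_comp_of_indexFormula 𝔓 _ π hI (hN N le_rfl) h3 b]
  congr 1
  exact herbrandPhi_eq_self_of_le 𝔓 π.ker
    (fun i hi => ramificationSubgroup_ker_eq_of_le R E 𝔓 hker hb hi) (Nat.cast_nonneg b) le_rfl

/-- `φ_{L/K}(b) = φ_{E/K}(b)` in the form used with `lowerIndex_eq_of_smul_eq_neg`: hypothesis
`i_G(ι) = b + 1`.  [cite: SerreLocalFields1979, Ch. IV §3 Prop. 15 (pp. 75–76)] -/
theorem herbrandPhi_eq_herbrandPhi_quotient_of_lowerIndex_eq {ι : L ≃ₐ[K] L}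
    (hker : ∀ σ : L ≃ₐ[K] L, AlgEquiv.restrictNormalHom E σ = 1 ↔ σ = 1 ∨ σ = ι)
    {b : ℕ} (hb : lowerIndex 𝔓 (L ≃ₐ[K] L) ι = b + 1) :
    herbrandPhi 𝔓 (L ≃ₐ[K] L) b =
      herbrandPhi (𝔓.comap (E.integralClosureInclusion R)) (E ≃ₐ[K] E) b :=
  herbrandPhi_eq_herbrandPhi_quotient_of_mem R E 𝔓 hker
    ((add_one_le_lowerIndex_iff 𝔓).mp (hb ▸ le_rfl))

omit [IsDedekindDomain R] [IsFractionRing R K] [𝔓.IsMaximal]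
  [Algebra.IsSeparable (R ⧸ 𝔓.under R) (integralClosure R L ⧸ 𝔓)] in
/-- **`#G₀ = 2 · #Q₀`**: if the kernel of `Gal(L/K) → Gal(E/K) = Q` is `{1, ι}` with `ι ≠ 1` in
the inertia group `G₀` of `𝔓`, then the inertia group `Q₀` of `𝔓 ∩ E` — the image of `G₀`
(Serre, Ch. I §7 Prop. 22) — has half the order of `G₀`.
[cite: SerreLocalFields1979, Ch. I §7 Prop. 22 and Ch. IV §1 Prop. 2] -/
theorem card_inertia_eq_two_mul_card_inertia_quotient [𝔓.IsPrime] {ι : L ≃ₐ[K] L} (hι : ι ≠ 1)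
    (hker : ∀ σ : L ≃ₐ[K] L, AlgEquiv.restrictNormalHom E σ = 1 ↔ σ = 1 ∨ σ = ι)
    (h0 : ι ∈ 𝔓.ramificationSubgroup (L ≃ₐ[K] L) 0) :
    Nat.card (𝔓.ramificationSubgroup (L ≃ₐ[K] L) 0) =
      2 * Nat.card ((𝔓.comap (E.integralClosureInclusion R)).ramificationSubgroup
        (E ≃ₐ[K] E) 0) := by
  classical
  set π : (L ≃ₐ[K] L) →* (E ≃ₐ[K] E) := AlgEquiv.restrictNormalHom E with hπ
  have hI : (𝔓.ramificationSubgroup (L ≃ₐ[K] L) 0).map π =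
      (𝔓.comap (E.integralClosureInclusion R)).ramificationSubgroup (E ≃ₐ[K] E) 0 := by
    rw [Ideal.ramificationSubgroup_zero, Ideal.ramificationSubgroup_zero]
    exact map_inertia_restrictNormalHom R E 𝔓
  have h := card_map_mul_card_ramificationSubgroup_ker 𝔓 π 0
  rw [hI] at h
  -- `#(ker π)_0 = 2`
  have hker0 : Nat.card (𝔓.ramificationSubgroup π.ker 0) = 2 := by
    have hset : ∀ x : π.ker, x ∈ 𝔓.ramificationSubgroup π.ker 0 ↔
        (x : L ≃ₐ[K] L) = 1 ∨ (x : L ≃ₐ[K] L) = ι := by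
      intro x
      rw [mem_ramificationSubgroup_subgroup_iff]
      constructor
      · intro _
        exact (hker x).mp (MonoidHom.mem_ker.mp x.2)
      · rintro (hx | hx)
        · rw [hx]; exact Subgroup.one_mem _
        · rw [hx]; exact h0
    have hιker : ι ∈ π.ker := MonoidHom.mem_ker.mpr ((hker ι).mpr (Or.inr rfl))
    let e : 𝔓.ramificationSubgroup π.ker 0 ≃ Bool :=
      { toFun := fun x => if ((x : π.ker) : L ≃ₐ[K] L) = 1 then false else true
        invFun := fun c => if c then ⟨⟨ι, hιker⟩, (hset _).mpr (Or.inr rfl)⟩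
          else ⟨1, Subgroup.one_mem _⟩
        left_inv := by
          rintro ⟨x, hx⟩
          rcases (hset x).mp hx with h1 | h1
          · have : x = 1 := Subtype.ext h1
            subst this
            simp
          · have hx1 : (x : L ≃ₐ[K] L) ≠ 1 := by rw [h1]; exact hι
            simp only [hx1, if_false, if_true]
            congr 1
            exact Subtype.ext h1.symm
        right_inv := by
          rintro (_ | _)
          · simp
          · simp [hι] }
    rw [Nat.card_congr e, Nat.card_eq_fintype_card, Fintype.card_bool]
  rw [hker0] at h
  omega

end Quotient

end Literature.NumberTheory.GaloisRepresentations

end
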